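import Literature.Algebra.Homology.RightDerivedFunctorPlusInjectiveModel
import Mathlib.Algebra.Homology.DerivedCategory.TStructure
import HarnessLib

/-!
# Cohomological concentration on `D⁺`: descent of `IsGE` ∕ `IsLE` along a conservative exact functor, and
# «one non-zero cohomology object ⇒ a shifted single object» (Weibel 10.5.2; BBD 1.3; Stacks 06XU)

Layer `Literature/Algebra/Homology` (pure homological algebra). For an exact functor `G : C ⥤ D` of abelian categories
which REFLECTS ISOMORPHISMS (e.g. `q^*` for `q` flat and surjective, `Modules/PullbackReflectsIsoOfFlatSurjective`; a
faithful exact functor), cohomological amplitude descends along `G`: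

* `isZero_of_isZero_obj` — a functor preserving zero morphisms and reflecting isomorphisms reflects zero objects;
* `exactAt_of_exactAt_map` — `G(K•)` exact at `i` ⇒ `K•` exact at `i` (`G` preserves homology: `Hⁱ(G K) = G(Hⁱ K)`);
* **`isLE_of_isLE_mapDerivedCategory_obj`**, **`isGE_of_isGE_mapDerivedCategory_obj`** — for `X ∈ D(C)`, if `D(G)(X)` is
  cohomologically `≤ n` (resp. `≥ n`) then so is `X`; and the `D⁺` forms `isLE_of_isLE_mapDerivedCategoryPlus_obj`,
  `isGE_of_isGE_mapDerivedCategoryPlus_obj` for `RightDerivedFunctorPlusInjectiveModel.mapDerivedCategoryPlus`;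
* **`Plus.exists_iso_singleFunctor_obj_of_isGE_of_isLE`** — an object of `D⁺(C)` which is both `≥ n` and `≤ n` is
  `(singleFunctor C n) Y` for some `Y : C` (Mathlib's `DerivedCategory.exists_iso_singleFunctor_obj_of_isGE_of_isLE`
  lifted along the fully faithful `ι : D⁺ ⥤ D`).

Everything PROVED; 0 named facts; no instances. Typed for the cell `pub-hodge-ring2` (the «(m) MODEL» step of the kernel road:
the descended transform `E` on Markman's secant quotient is a shifted sheaf as soon as `q^*E` is, `q` the finite flat quotient
map); a research route conditional on HC_CM, not a corollary — nothing in this file refers to it.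

## References

* C. A. Weibel, *An introduction to homological algebra* (1994), Exact Functors 10.5.2, 10.4 (truncations). [Weibel1994]
* A. Beilinson, J. Bernstein, P. Deligne, *Faisceaux pervers*, Astérisque 100 (1982), §1.3 (t-structures; the heart). [BBD1982]
* The Stacks Project, Tag 06XU (the canonical t-structure on `D(A)`). [StacksProject]
-/

noncomputable section

open CategoryTheory CategoryTheory.Limits

universe w w' v v' u u'

namespace Literature.Algebra.Homology

/-! ### §1 Conservative functors reflect zero objects and exactness -/

section Reflect

variable {C : Type u} [Category.{v} C] {D : Type u'} [Category.{v'} D]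

/-- **A functor preserving zero morphisms and reflecting isomorphisms reflects zero objects**: if `G M ≅ 0` then
`M ≅ 0` (the zero endomorphism of `M` is mapped to the zero endomorphism of a zero object, an isomorphism).
[cite: StacksProject, Tag 06XU (conservative exact functors)] -/
theorem isZero_of_isZero_obj [HasZeroMorphisms C] [HasZeroMorphisms D] (G : C ⥤ D) [G.PreservesZeroMorphisms]
    [G.ReflectsIsomorphisms] {M : C} (h : IsZero (G.obj M)) : IsZero M := by
  have h0 : IsIso (G.map (0 : M ⟶ M)) := by
    rw [G.map_zero, ← h.eq_of_src (𝟙 _) 0]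
    infer_instance
  haveI : IsIso (0 : M ⟶ M) := isIso_of_reflects_iso (0 : M ⟶ M) G
  rw [IsZero.iff_id_eq_zero, ← IsIso.hom_inv_id (0 : M ⟶ M), zero_comp]

variable [Abelian C] [Abelian D] (G : C ⥤ D) [G.Additive] [G.PreservesHomology] [G.ReflectsIsomorphisms]

/-- **Exactness descends along a conservative homology-preserving functor**: for a complex `K•` (any shape), if
`G(K•)` is exact at `i` then `K•` is exact at `i` (`Hⁱ(G K•) ≅ G(Hⁱ K•)`, and `G` reflects zero objects).
[cite: Weibel1994, Exact Functors 10.5.2] -/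
theorem exactAt_of_exactAt_map {ι : Type*} {c : ComplexShape ι} (K : HomologicalComplex C c) (i : ι)
    (h : ((G.mapHomologicalComplex c).obj K).ExactAt i) : K.ExactAt i := by
  rw [HomologicalComplex.exactAt_iff_isZero_homology] at h ⊢
  exact isZero_of_isZero_obj G (h.of_iso ((K.sc i).mapHomologyIso G).symm)

end Reflect

/-! ### §2 Cohomological amplitude descends along `D(G)` and `D⁺(G)` -/

section Amplitude

variable {C : Type u} [Category.{v} C] [Abelian C] [HasDerivedCategory.{w} C]
  {D : Type u'} [Category.{v'} D] [Abelian D] [HasDerivedCategory.{w'} D]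
  (G : C ⥤ D) [G.Additive] [PreservesFiniteLimits G] [PreservesFiniteColimits G] [G.ReflectsIsomorphisms]

/-- **`D(G)(X) ≤ n ⇒ X ≤ n`** for a conservative exact functor `G` (cohomology sheaves: `Hⁱ(D(G) X) = G(Hⁱ X)`).
[cite: Weibel1994, Exact Functors 10.5.2] [cite: BBD1982, §1.3] -/
theorem isLE_of_isLE_mapDerivedCategory_obj (X : DerivedCategory C) (n : ℤ) [h : (G.mapDerivedCategory.obj X).IsLE n] :
    X.IsLE n := by
  let K := DerivedCategory.Q.objPreimage X
  have e : DerivedCategory.Q.obj K ≅ X := DerivedCategory.Q.objObjPreimageIso X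
  haveI : (DerivedCategory.Q.obj ((G.mapHomologicalComplex (ComplexShape.up ℤ)).obj K)).IsLE n :=
    DerivedCategory.TStructure.t.isLE_of_iso
      (G.mapDerivedCategory.mapIso e.symm ≪≫ G.mapDerivedCategoryFactors.app K) n
  have hK : CochainComplex.IsLE ((G.mapHomologicalComplex (ComplexShape.up ℤ)).obj K) n :=
    (DerivedCategory.isLE_Q_obj_iff _ n).mp inferInstance
  have hK' : K.IsLE n := by
    rw [CochainComplex.isLE_iff] at hK ⊢
    exact fun i hi => exactAt_of_exactAt_map G K i (hK i hi)
  haveI : (DerivedCategory.Q.obj K).IsLE n := (DerivedCategory.isLE_Q_obj_iff K n).mpr hK'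
  exact DerivedCategory.TStructure.t.isLE_of_iso e n

/-- **`D(G)(X) ≥ n ⇒ X ≥ n`** for a conservative exact functor `G`. [cite: Weibel1994, Exact Functors 10.5.2] [cite: BBD1982, §1.3] -/
theorem isGE_of_isGE_mapDerivedCategory_obj (X : DerivedCategory C) (n : ℤ) [h : (G.mapDerivedCategory.obj X).IsGE n] :
    X.IsGE n := by
  let K := DerivedCategory.Q.objPreimage X
  have e : DerivedCategory.Q.obj K ≅ X := DerivedCategory.Q.objObjPreimageIso X
  haveI : (DerivedCategory.Q.obj ((G.mapHomologicalComplex (ComplexShape.up ℤ)).obj K)).IsGE n :=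
    DerivedCategory.TStructure.t.isGE_of_iso
      (G.mapDerivedCategory.mapIso e.symm ≪≫ G.mapDerivedCategoryFactors.app K) n
  have hK : CochainComplex.IsGE ((G.mapHomologicalComplex (ComplexShape.up ℤ)).obj K) n :=
    (DerivedCategory.isGE_Q_obj_iff _ n).mp inferInstance
  have hK' : K.IsGE n := by
    rw [CochainComplex.isGE_iff] at hK ⊢
    exact fun i hi => exactAt_of_exactAt_map G K i (hK i hi)
  haveI : (DerivedCategory.Q.obj K).IsGE n := (DerivedCategory.isGE_Q_obj_iff K n).mpr hK'
  exact DerivedCategory.TStructure.t.isGE_of_iso e n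

/-- **`D⁺(G)(X) ≤ n ⇒ X ≤ n`** on the bounded-below derived categories. [cite: Weibel1994, Exact Functors 10.5.2] [cite: BBD1982, §1.3] -/
theorem isLE_of_isLE_mapDerivedCategoryPlus_obj (X : DerivedCategory.Plus C) (n : ℤ) [h : (G.mapDerivedCategoryPlus.obj X).IsLE n] :
    X.IsLE n := by
  rw [← DerivedCategory.Plus.isLE_ι_obj_iff] at h ⊢
  change (G.mapDerivedCategory.obj (DerivedCategory.Plus.ι.obj X)).IsLE n at h
  exact isLE_of_isLE_mapDerivedCategory_obj G _ n

/-- **`D⁺(G)(X) ≥ n ⇒ X ≥ n`** on the bounded-below derived categories. [cite: Weibel1994, Exact Functors 10.5.2] [cite: BBD1982, §1.3] -/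
theorem isGE_of_isGE_mapDerivedCategoryPlus_obj (X : DerivedCategory.Plus C) (n : ℤ) [h : (G.mapDerivedCategoryPlus.obj X).IsGE n] :
    X.IsGE n := by
  rw [← DerivedCategory.Plus.isGE_ι_obj_iff] at h ⊢
  change (G.mapDerivedCategory.obj (DerivedCategory.Plus.ι.obj X)).IsGE n at h
  exact isGE_of_isGE_mapDerivedCategory_obj G _ n

end Amplitude

/-! ### §3 One non-zero cohomology object: a shifted single object -/

section Single

variable {C : Type u} [Category.{v} C] [Abelian C] [HasDerivedCategory.{w} C]

/-- **An object of `D⁺(C)` cohomologically concentrated in degree `n` is `Y[-n]` for some `Y : C`** (the heart of the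
canonical t-structure; Mathlib's `exists_iso_singleFunctor_obj_of_isGE_of_isLE` lifted along `ι : D⁺ ⥤ D`).
[cite: BBD1982, §1.3 (the heart)] [cite: StacksProject, Tag 06XU] -/
theorem Plus.exists_iso_singleFunctor_obj_of_isGE_of_isLE (X : DerivedCategory.Plus C) (n : ℤ) [X.IsGE n] [X.IsLE n] :
    ∃ Y : C, Nonempty (X ≅ (DerivedCategory.Plus.singleFunctor C n).obj Y) := by
  obtain ⟨Y, ⟨e⟩⟩ := DerivedCategory.exists_iso_singleFunctor_obj_of_isGE_of_isLE (DerivedCategory.Plus.ι.obj X) n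
  exact ⟨Y, ⟨(DerivedCategory.TStructure.t (C := C)).plus.fullyFaithfulι.preimageIso
    (e ≪≫ ((DerivedCategory.Plus.singleFunctorιIso C n).app Y).symm)⟩⟩

end Single

end Literature.Algebra.Homology

end
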